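import Summits.QuantumFields.YangMills.Theses.ContractibleFibre
import Summits.QuantumFields.YangMills.Theorems.NonSimplyConnectedLatticeGap.Negative.FalseWithoutTimeBound
import Literature.Barriers.QuantumFields.DiscreteSubgroupFreezing
import Summits.QuantumFields.YangMills.Theorems.LatticeGapOnTrajectory.Negative.ZeroCoupling

/-!
# Disproof of `FibreToTorus` (stmt-QuantumFields-16244) — standing disprover's work file

Crux `Summit.QuantumFields.YangMills.Theses.ContractibleFibre.FibreToTorus` (route `ContractibleFibre`, rank 4):
`∀ G simple, ∀ r faithful unitary, TubeFamily G r → TorusGap G r` — IF one rate `m(β) > 0` with width-uniform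
constants clusters the FREE tubes `(ℤ/L)²×{0..M}²` of every width in time for all `β ≥ β₁` (verbatim the
conclusion of `FibreContinuity`), THEN the `UniformLatticeGap` body holds for `r` on the SYMMETRIC tori `(2S+1)⁴`
(`S`-uniform constants, `n ≤ S`).

## Findings (cycle 1, refuter-cdisprove-stmt-QuantumFields-16244-0, 2026-08-17)

* **No unconditional kill exists, and none can exist from junk.**  `¬ FibreToTorus` needs an admissible `(G, r)`
  with `TubeFamily G r ∧ ¬ TorusGap G r`; `¬ TorusGap G r` is the failure of the weak-coupling lattice mass gap
  for a compact simple Lie group — nobody can prove it (and it is expected false), while `TubeFamily G r` is the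
  open conclusion of `FibreContinuity`.  Junk audit (§1): `IsCompactSimpleLieGroup` excludes the trivial,
  finite and abelian groups and forces `G` Hausdorff, second countable, `r.N ≥ 2`; the tube expectation `Ex` is a
  genuine normalised Gibbs average (`cov_ratio_le_two`: `wgt = e^{act} > 0` continuous on a compact
  configuration space, `ν` = product of Haar PROBABILITY measures); `latticeConnectedCorr` lives under the
  probability measure `wilsonMeasure` (tree `isProbabilityMeasure_wilsonMeasure`); quantifier order = informal
  text; `ins` switches off exactly the fibre-wrapping plaquettes; tube and torus `β`-conventions agree
  (`wilsonAction = ∑ (N − Re tr)`, the constant cancels on normalisation).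
* **§2 (conclusion side) `n ≤ S` is load-bearing** — LANDABLE: the all-times strengthening `TorusGapAllTimes` is
  false for every admissible `(G, r)` (`torusGapAllTimes_false`, = tree
  `NonSimplyConnectedLatticeGap.Negative.nonSimplyConnectedLatticeGap_false_without_timeBound_at`), hence the
  all-times CRUX is equivalent to `∀ G r, ¬ TubeFamily G r` (`fibreToTorusAllTimes_iff_no_tubeFamily`): without
  the time bound the crux is a disguised negation of its own hypothesis.  Lesson for stub (V) provers: vacuum
  dominance is spent exactly on excluding `S < n ≤ 2S`; no argument can give all `n`.
* **§3 (hypothesis side) the rate `0 < m` carries ALL the content of the hypothesis** — LANDABLE: with `m = 0`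
  the tube predicate holds for EVERY compact `G`, `r`, `β`, `M`, `w`, with `C = 2`, `Lmin = 0`
  (`tubeClusters_rate_zero`, from `cov_ratio_le_two`); so the crux with `0 < m ∧` deleted from its hypothesis
  (`FibreToTorusNoRate`) is EQUIVALENT to the target `UniformLatticeGap` (`fibreToTorusNoRate_iff_uniformLatticeGap`).
  The same tautology sinks the variants "`C` may depend on `L`" and "`∃ L` instead of `∀ L ≥ Lmin`" (remarks in §3):
  the non-trivial content of `TubeFamily` is precisely "one `m > 0` and one `C` serve all `L ≥ Lmin(M)` through
  `2n < L` with `n` unbounded" — i.e. a UNIFORM-in-`L` (and in `M`) spectral statement about the free-fibre transfer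
  matrices, as the strategist's census §0(i) says informally.
* **§4 (hypothesis side) the separation bound `2n < L` keeps the hypothesis SATISFIABLE** — LANDABLE: with
  `2 * n < L →` deleted the tube predicate is false for every non-trivial compact `G`, faithful `r`, `M`, `β`, `w`,
  `Lmin`, `C` as soon as `m > 0` (`tubeClustersAllSep_false`: time-periodicity `σ_{kL} = id` + positive variance
  of the one-link character `Re tr r.ρ(U_ℓ)/N` under the tube Gibbs measure, `var_ratio_pos` /
  `allSep_bound_false`), so the crux so mutated would close VACUOUSLY (`tubeFamilyAllSep_false`) — the dual of §2.
* **§5 non-vacuity of the hypothesis IN KIND** — LANDABLE: at `β = 0` the tube predicate holds for EVERY rate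
  `m ≥ 0` with `C(w) = 2e^{mw}`, `Lmin = 0` (`tubeClusters_coupling_zero`: for `n ≤ w` the a-priori bound, for
  `w < n < L/2` the slab and its shift are disjoint mod `L` and the covariance factorises under product Haar —
  tree `integral_mul_eq_of_dependsOn_disjoint`); so the quantifier placement `∃ m ∀ w ∃ C ∀ M ∃ Lmin` is consistent
  and the shape cannot be refuted by bookkeeping (the family is of course asked for all LARGE `β`, where it is the
  open `FibreContinuity`).  The proof exercises `Loc`/`σ`/`ZMod.val` slab arithmetic once — idioms for stub (T).
* **§6 hypothesis mutations that cannot be closed (why the crux resists)**: dropping `IsCompactSimpleLieGroup`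
  (trivial group: both bodies hold; `U(1)`: hypothesis false, vacuous; finite groups: both bodies expected true at
  large `β` — `DiscreteSubgroupFreezing`); dropping `M`-uniformity of `C` or the order `∀ M ∃ Lmin`; the pointwise-`β`
  variant (B1 of `BarrierNotes-ideator1-r1.md`); `FibreToTorus_false_without_family` (weakening the hypothesis to
  "a clustering time-RP DLR state exists", what stub (T) extracts): EVERY such `¬` needs `¬ TorusGap` at an
  admissible `(G, r)` or a provably non-clustering Wilson torus state at some large `β` — confinement-era physics,
  not available.  The ABSTRACT shadow is false (free b.c. select one phase, periodic b.c. mix: Potts `q ≫ 1` at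
  `β_c`, Grimmett Thm 7.33; a hard-constraint 4-d toy in the crux's own geometry: link states `{0}∪{1..q}`, plaquette weight `K` on all-`0`, `1` on all-non-zero, `0` mixed, `K⁶ = q⁴`; tori are `½`-`½` mixtures with `Cov = ¼` at every `n`, free tubes are the disordered product state up to weight `k^{-L²(6M+4)}`, so the tube family holds with `m = 1`, `C(w) = 4e^w + 4` — not formalised, ~500 lines of connectivity combinatorics for no new information) — so any proof
  must use Wilson-specific weak-coupling input (uniqueness (U) + finite-size (V) of line `uniqueness`).
* **§7 stub audit of the picked line `uniqueness` (T → U → V)**: no junk model — `IsGibbsMeasure` carries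
  `IsProbabilityMeasure` (the zero measure is not DLR, so (T) is not junk-closable and (U) not junk-false);
  `infiniteVolumeLimitPoints` is non-empty (compactness) so (V)'s antecedent is substantive; (T) holds at `β = 0`
  consistently (product Haar: covariances vanish beyond the support diameter); (U), (V) irreducible here.

Namespace `Summit.QuantumFields.YangMills.Cruxes.FibreToTorus.Disproof`; prose only in docstrings; `sorry` only in
near-misses (none at present).  Extracted landings (def-free copies): `Theorems/FibreToTorus/Negative/TimeBoundLoadBearing.lean`
(§2, p159037 ACCEPTED), `…/RateLoadBearing.lean` (§3, p160742 ACCEPTED), `…/SeparationBoundLoadBearing.lean` (§4, p161065), `…/ZeroCouplingWitness.lean` (§5).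
-/

noncomputable section

namespace Summit.QuantumFields.YangMills.Cruxes.FibreToTorus.Disproof

open MeasureTheory Filter Topology
open Literature.MathematicalPhysics.QuantumFieldTheory

/-! ## §0 The bodies of the crux, named (verbatim copies of the route file's inline text) -/

/-- The free-tube clustering predicate `Tube M β m C w Lmin` of the route file for `(G, r)`, all parameters
explicit: on every free tube `(ℤ/L)²×Fin(M+1)²` with `L ≥ Lmin`, every pair of bounded measurable time-slab
observables (width `w`, `|F| ≤ 1`) clusters in time at rate `m` with constant `C`, for `2n < L`. [folklore] -/
def TubeClusters (G : Type) [Group G] [TopologicalSpace G] [IsTopologicalGroup G] [CompactSpace G]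
    [MeasurableSpace G] [BorelSpace G] (r : LatticeRep G) (M : ℕ) (β m C : ℝ) (w Lmin : ℕ) : Prop :=
  ∀ (L : ℕ) [NeZero L], Lmin ≤ L → let St := ZMod L × ZMod L × Fin (M + 1) × Fin (M + 1); let Cfg := St × Fin 4 → G; let ν : MeasureTheory.Measure Cfg := MeasureTheory.Measure.pi fun _ => haarProbability G; let sh : St → Fin 4 → St := fun x μ => ![(x.1 + 1, x.2.1, x.2.2.1, x.2.2.2), (x.1, x.2.1 + 1, x.2.2.1, x.2.2.2), (x.1, x.2.1, x.2.2.1 + 1, x.2.2.2), (x.1, x.2.1, x.2.2.1, x.2.2.2 + 1)] μ; let ins : St → Fin 4 → Fin 4 → ℝ := fun x μ κ => if ((μ = 2 ∨ κ = 2) → (x.2.2.1 : ℕ) < M) ∧ ((μ = 3 ∨ κ = 3) → (x.2.2.2 : ℕ) < M) then 1 else 0; let pl : Cfg → St → Fin 4 → Fin 4 → G := fun U x μ κ => U (x, μ) * U (sh x μ, κ) * (U (sh x κ, μ))⁻¹ * (U (x, κ))⁻¹; let act : Cfg → ℝ := fun U => β * ∑ x : St, ∑ q : {q : Fin 4 ×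 Fin 4 // q.1 < q.2}, ins x q.1.1 q.1.2 * (r.ρ (pl U x q.1.1 q.1.2)).trace.re; let wgt : Cfg → ℝ := fun U => Real.exp (act U); let Ex : (Cfg → ℝ) → ℝ := fun F => (∫ U, F U * wgt U ∂ν) / (∫ U, wgt U ∂ν); let σ : ℕ → Cfg → Cfg := fun n U p => U ((p.1.1 + n, p.1.2), p.2); ∀ c : ZMod L, let Loc := fun F : Cfg → ℝ => Measurable F ∧ (∀ U, |F U| ≤ 1) ∧ ∀ U U', (∀ p : St × Fin 4, (p.1.1 - c).val ≤ w → U p = U' p) → F U = F U'; ∀ F₁ F₂ : Cfg → ℝ, Loc F₁ → Loc F₂ → ∀ n : ℕ, 2 * n < L → |Ex (fun U => F₁ U * F₂ (σ n U)) - Ex F₁ * Ex (fun U => F₂ (σ n U))| ≤ C * Real.exp (-(m * n))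

/-- **The hypothesis of `FibreToTorus` for `(G, r)`**: one rate, width-uniform constants —
`∃ β₁ ∀ β ≥ β₁ ∃ m > 0 ∀ w ∃ C ∀ M ∃ Lmin, TubeClusters G r M β m C w Lmin` (the conclusion of `FibreContinuity`). [folklore] -/
def TubeFamily (G : Type) [Group G] [TopologicalSpace G] [IsTopologicalGroup G] [CompactSpace G]
    [MeasurableSpace G] [BorelSpace G] (r : LatticeRep G) : Prop :=
  ∃ β₁ : ℝ, ∀ β : ℝ, β₁ ≤ β → ∃ m : ℝ, 0 < m ∧ ∀ w : ℕ, ∃ C : ℝ, ∀ M : ℕ, ∃ Lmin : ℕ,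
    TubeClusters G r M β m C w Lmin

/-- **The conclusion of `FibreToTorus` for `(G, r)`** — the `UniformLatticeGap` body for `r`. [folklore] -/
def TorusGap (G : Type) [Group G] [TopologicalSpace G] [IsTopologicalGroup G] [CompactSpace G]
    [MeasurableSpace G] [BorelSpace G] (r : LatticeRep G) : Prop :=
  ∃ β₀ : ℝ, ∀ β : ℝ, β₀ ≤ β → ∃ m : ℝ, 0 < m ∧ ∃ S₁ : ℕ, ∀ A B : YMSpecies G, ∃ C : ℝ, ∀ S n : ℕ,
    S₁ ≤ S → n ≤ S → |latticeConnectedCorr r.ρ β (2 * S + 1) A.F B.F n| ≤ C * Real.exp (-(m * n))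

/-- **The crux, unbundled** (kernel-checked, `Iff.rfl`): `FibreToTorus` IS
`∀ G simple (Borel σ-algebra), ∀ r, TubeFamily G r → TorusGap G r`. [folklore] -/
theorem fibreToTorus_iff :
    Summit.QuantumFields.YangMills.Theses.ContractibleFibre.FibreToTorus ↔
      ∀ (G : Type) [Group G] [TopologicalSpace G] [IsTopologicalGroup G] [CompactSpace G],
        IsCompactSimpleLieGroup G → letI : MeasurableSpace G := borel G; haveI : BorelSpace G := ⟨rfl⟩;
        ∀ r : LatticeRep G, TubeFamily G r → TorusGap G r :=
  Iff.rfl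

/-- Sanity (kernel-checked): the target `UniformLatticeGap` IS `∀ G simple, ∀ r, TorusGap G r` (over every Borel
structure on `G`). -/
example : Summit.QuantumFields.YangMills.Theses.ContractibleFibre.UniformLatticeGap ↔
    ∀ (G : Type) [Group G] [TopologicalSpace G] [IsTopologicalGroup G] [CompactSpace G] [MeasurableSpace G]
      [BorelSpace G], IsCompactSimpleLieGroup G → ∀ r : LatticeRep G, TorusGap G r :=
  Iff.rfl

variable {G : Type} [Group G] [TopologicalSpace G] [IsTopologicalGroup G] [CompactSpace G]
  [MeasurableSpace G] [BorelSpace G]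

/-! ## §2 Conclusion side: the time bound `n ≤ S` is load-bearing -/

/-- `TorusGap` with the time bound `n ≤ S` deleted. [folklore] -/
def TorusGapAllTimes (G : Type) [Group G] [TopologicalSpace G] [IsTopologicalGroup G] [CompactSpace G]
    [MeasurableSpace G] [BorelSpace G] (r : LatticeRep G) : Prop :=
  ∃ β₀ : ℝ, ∀ β : ℝ, β₀ ≤ β → ∃ m : ℝ, 0 < m ∧ ∃ S₁ : ℕ, ∀ A B : YMSpecies G, ∃ C : ℝ, ∀ S n : ℕ,
    S₁ ≤ S → |latticeConnectedCorr r.ρ β (2 * S + 1) A.F B.F n| ≤ C * Real.exp (-(m * n))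

/-- **`TorusGapAllTimes` is false for every admissible `(G, r)`** (periodicity in `n` with period `2S+1` against
the positive plaquette variance; tree lemma of the sibling crux `NonSimplyConnectedLatticeGap`, same body). [folklore] -/
theorem torusGapAllTimes_false (hG : IsCompactSimpleLieGroup G) (r : LatticeRep G) : ¬ TorusGapAllTimes G r :=
  Summit.QuantumFields.YangMills.Theorems.NonSimplyConnectedLatticeGap.Negative.nonSimplyConnectedLatticeGap_false_without_timeBound_at
    hG r

/-- The crux with its conclusion replaced by the all-times strengthening (hypothesis verbatim). [folklore] -/
def FibreToTorusAllTimes : Prop :=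
  ∀ (G : Type) [Group G] [TopologicalSpace G] [IsTopologicalGroup G] [CompactSpace G],
    IsCompactSimpleLieGroup G → letI : MeasurableSpace G := borel G; haveI : BorelSpace G := ⟨rfl⟩;
    ∀ r : LatticeRep G, TubeFamily G r → TorusGapAllTimes G r

/-- **Without `n ≤ S` the crux is a disguised `¬ hypothesis`**: `FibreToTorusAllTimes ↔ ∀ G simple ∀ r, ¬ TubeFamily G r`. [folklore] -/
theorem fibreToTorusAllTimes_iff_no_tubeFamily :
    FibreToTorusAllTimes ↔
      ∀ (G : Type) [Group G] [TopologicalSpace G] [IsTopologicalGroup G] [CompactSpace G],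
        IsCompactSimpleLieGroup G → letI : MeasurableSpace G := borel G; haveI : BorelSpace G := ⟨rfl⟩;
        ∀ r : LatticeRep G, ¬ TubeFamily G r := by
  constructor
  · intro h G _ _ _ _ hG
    letI : MeasurableSpace G := borel G
    haveI : BorelSpace G := ⟨rfl⟩
    intro r hT
    exact torusGapAllTimes_false hG r (h G hG r hT)
  · intro h G _ _ _ _ hG
    letI : MeasurableSpace G := borel G
    haveI : BorelSpace G := ⟨rfl⟩
    intro r hT
    exact absurd hT (h G hG r)

/-! ## §3 Hypothesis side: the rate `0 < m` carries all the content of `TubeFamily` -/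

/-- **A ratio-of-integrals Gibbs average is a genuine average.** For a continuous "action" `act` on a compact
configuration space with a probability reference measure `ν`, the normalised expectation
`Ex F = (∫ F e^{act} dν)/(∫ e^{act} dν)` satisfies `|Ex F| ≤ 1` whenever `|F| ≤ 1`, hence every "connected
correlation" `Ex (F₁ G₂) − Ex F₁ · Ex G₂` of such observables is bounded by `2` — with no measurability needed
(non-integrable numerators give `0`). This is the shape of the route file's inline `Ex`. [folklore] -/
theorem cov_ratio_le_two {Ω : Type*} [MeasurableSpace Ω] [TopologicalSpace Ω] [OpensMeasurableSpace Ω]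
    [CompactSpace Ω] (ν : Measure Ω) [IsProbabilityMeasure ν] {act : Ω → ℝ} (hact : Continuous act)
    {F₁ G₂ : Ω → ℝ} (h1 : ∀ U, |F₁ U| ≤ 1) (h2 : ∀ U, |G₂ U| ≤ 1) :
    |(∫ U, F₁ U * G₂ U * Real.exp (act U) ∂ν) / (∫ U, Real.exp (act U) ∂ν) -
      (∫ U, F₁ U * Real.exp (act U) ∂ν) / (∫ U, Real.exp (act U) ∂ν) *
        ((∫ U, G₂ U * Real.exp (act U) ∂ν) / (∫ U, Real.exp (act U) ∂ν))| ≤ 2 := by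
  have hw_cont : Continuous fun U => Real.exp (act U) := Real.continuous_exp.comp hact
  have hw_int : Integrable (fun U => Real.exp (act U)) ν :=
    hw_cont.integrable_of_hasCompactSupport (isClosed_tsupport _).isCompact
  have hw0 : ∀ U, 0 ≤ Real.exp (act U) := fun U => (Real.exp_pos _).le
  have hZ : 0 < ∫ U, Real.exp (act U) ∂ν := integral_exp_pos hw_int
  -- the generic bound `|Ex H| ≤ 1` for `|H| ≤ 1`
  have key : ∀ {H : Ω → ℝ}, (∀ U, |H U| ≤ 1) →
      |(∫ U, H U * Real.exp (act U) ∂ν) / (∫ U, Real.exp (act U) ∂ν)| ≤ 1 := by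
    intro H hH1
    rw [abs_div, abs_of_pos hZ, div_le_one hZ]
    calc |∫ U, H U * Real.exp (act U) ∂ν| ≤ ∫ U, |H U * Real.exp (act U)| ∂ν := abs_integral_le_integral_abs
      _ ≤ ∫ U, Real.exp (act U) ∂ν := by
          refine integral_mono_of_nonneg (Eventually.of_forall fun U => abs_nonneg _) hw_int
            (Eventually.of_forall fun U => ?_)
          show |H U * Real.exp (act U)| ≤ Real.exp (act U)
          rw [abs_mul, abs_of_nonneg (hw0 U)]
          exact mul_le_of_le_one_left (hw0 U) (hH1 U)
  have hA : |(∫ U, F₁ U * G₂ U * Real.exp (act U) ∂ν) / (∫ U, Real.exp (act U) ∂ν)| ≤ 1 :=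
    key fun U => by rw [abs_mul]; exact mul_le_one₀ (h1 U) (abs_nonneg _) (h2 U)
  have hB := key h1
  have hC := key h2
  calc _ ≤ |(∫ U, F₁ U * G₂ U * Real.exp (act U) ∂ν) / (∫ U, Real.exp (act U) ∂ν)| +
        |(∫ U, F₁ U * Real.exp (act U) ∂ν) / (∫ U, Real.exp (act U) ∂ν) *
          ((∫ U, G₂ U * Real.exp (act U) ∂ν) / (∫ U, Real.exp (act U) ∂ν))| := abs_sub _ _
    _ ≤ 1 + 1 * 1 := by
        rw [abs_mul]
        exact add_le_add hA (mul_le_mul hB hC (abs_nonneg _) zero_le_one)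
    _ = 2 := by norm_num

/-- **With rate `m = 0` the tube predicate is a tautology**: for EVERY compact `G`, faithful `r`, width `M`,
coupling `β` (any sign) and slab width `w`, `TubeClusters G r M β 0 2 w 0` — the free-tube expectation is a genuine
normalised Gibbs average, so every connected correlation of slab observables with `|F| ≤ 1` is `≤ 2 = 2·e^{-0·n}`.
Hence the positivity of the rate (used through `2n < L` with `n` unbounded as `L → ∞`) is what gives the
hypothesis of `FibreToTorus` content. [folklore] -/
theorem tubeClusters_rate_zero (r : LatticeRep G) (M : ℕ) (β : ℝ) (w : ℕ) :
    TubeClusters G r M β 0 2 w 0 := by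
  haveI : SecondCountableTopology G :=
    (r.continuous.isClosedEmbedding r.injective).isEmbedding.secondCountableTopology
  have hρ : Continuous fun g : G => ((r.ρ g).trace).re :=
    Complex.continuous_re.comp r.continuous.matrix_trace
  intro L _ _
  dsimp only
  intro c F₁ F₂ hF₁ hF₂ n _
  refine (cov_ratio_le_two (MeasureTheory.Measure.pi fun _ => haarProbability G) ?_ hF₁.2.1
    (fun U => hF₂.2.1 _)).trans_eq ?_
  · refine continuous_const.mul (continuous_finsetSum _ fun x _ =>
      continuous_finsetSum _ fun q _ => continuous_const.mul (hρ.comp ?_))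
    fun_prop
  · simp

/-- `TubeFamily` with the positivity of the rate (`0 < m ∧`) deleted. [folklore] -/
def TubeFamilyNoRate (G : Type) [Group G] [TopologicalSpace G] [IsTopologicalGroup G] [CompactSpace G]
    [MeasurableSpace G] [BorelSpace G] (r : LatticeRep G) : Prop :=
  ∃ β₁ : ℝ, ∀ β : ℝ, β₁ ≤ β → ∃ m : ℝ, ∀ w : ℕ, ∃ C : ℝ, ∀ M : ℕ, ∃ Lmin : ℕ,
    TubeClusters G r M β m C w Lmin

/-- **`TubeFamilyNoRate` holds for every compact `G` and faithful `r`** (`m = 0`, `C = 2`, `Lmin = 0`, any `β₁`). [folklore] -/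
theorem tubeFamilyNoRate_holds (r : LatticeRep G) : TubeFamilyNoRate G r :=
  ⟨0, fun β _ => ⟨0, fun w => ⟨2, fun M => ⟨0, tubeClusters_rate_zero r M β w⟩⟩⟩⟩

/-- The crux with `0 < m ∧` deleted from its hypothesis (conclusion verbatim). [folklore] -/
def FibreToTorusNoRate : Prop :=
  ∀ (G : Type) [Group G] [TopologicalSpace G] [IsTopologicalGroup G] [CompactSpace G],
    IsCompactSimpleLieGroup G → letI : MeasurableSpace G := borel G; haveI : BorelSpace G := ⟨rfl⟩;
    ∀ r : LatticeRep G, TubeFamilyNoRate G r → TorusGap G r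

/-- **Without the rate the crux IS the target**: `FibreToTorusNoRate ↔ UniformLatticeGap` — deleting `0 < m`
from the hypothesis of `FibreToTorus` leaves exactly the `UniformLatticeGap` item (stmt-QuantumFields-8778).
(`→`: the rate-free hypothesis holds for every `(G, r)`, `tubeFamilyNoRate_holds`, and the conclusion for the Borel
σ-algebra is the conclusion for any `[BorelSpace G]` structure; `←`: the target gives the conclusion outright.) [folklore] -/
theorem fibreToTorusNoRate_iff_uniformLatticeGap :
    FibreToTorusNoRate ↔ Summit.QuantumFields.YangMills.Theses.ContractibleFibre.UniformLatticeGap := by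
  constructor
  · intro h G _ _ _ _ _ _ hG r
    have hm : ‹MeasurableSpace G› = borel G := BorelSpace.measurable_eq
    subst hm
    letI : MeasurableSpace G := borel G
    exact h G hG r (tubeFamilyNoRate_holds r)
  · intro hU G _ _ _ _ hG
    letI : MeasurableSpace G := borel G
    haveI : BorelSpace G := ⟨rfl⟩
    intro r _
    exact hU G hG r

/-! ## §4 Hypothesis side: the separation bound `2n < L` is what keeps `TubeFamily` satisfiable -/

omit [IsTopologicalGroup G] [CompactSpace G] [MeasurableSpace G] [BorelSpace G] in
/-- `|Re tr r.ρ(g)| ≤ N` for a unitary matrix representation (entries of a unitary matrix have norm `≤ 1`). [folklore] -/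
theorem abs_re_trace_le (r : LatticeRep G) (g : G) : |((r.ρ g).trace).re| ≤ r.N := by
  have h1 : |((r.ρ g).trace).re| ≤ ‖(r.ρ g).trace‖ := Complex.abs_re_le_norm _
  have h2 : ‖(r.ρ g).trace‖ ≤ ∑ i, ‖(r.ρ g) i i‖ := by
    rw [Matrix.trace]; exact norm_sum_le _ _
  have h3 : ∑ i, ‖(r.ρ g) i i‖ ≤ ∑ _i : Fin r.N, (1 : ℝ) :=
    Finset.sum_le_sum fun i _ => entry_norm_bound_of_unitary (r.mem_unitary g) i i
  simp only [Finset.sum_const, Finset.card_univ, Fintype.card_fin, nsmul_eq_mul, mul_one] at h3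
  linarith

/-- **Positive variance in ratio form.** For a continuous `act` on a compact configuration space whose probability
reference measure `ν` charges open sets, a continuous observable `F` taking two different values has
`Ex (F·F) − (Ex F)² > 0`, `Ex H = (∫ H e^{act} dν)/(∫ e^{act} dν)`. [folklore] -/
theorem var_ratio_pos {Ω : Type*} [MeasurableSpace Ω] [TopologicalSpace Ω] [OpensMeasurableSpace Ω]
    [CompactSpace Ω] (ν : Measure Ω) [IsProbabilityMeasure ν] [ν.IsOpenPosMeasure] {act : Ω → ℝ}
    (hact : Continuous act) {F : Ω → ℝ} (hF : Continuous F) {U₀ V₀ : Ω} (hUV : F U₀ ≠ F V₀) :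
    0 < (∫ U, F U * F U * Real.exp (act U) ∂ν) / (∫ U, Real.exp (act U) ∂ν) -
      (∫ U, F U * Real.exp (act U) ∂ν) / (∫ U, Real.exp (act U) ∂ν) *
        ((∫ U, F U * Real.exp (act U) ∂ν) / (∫ U, Real.exp (act U) ∂ν)) := by
  have hw_cont : Continuous fun U => Real.exp (act U) := Real.continuous_exp.comp hact
  have hcs : ∀ f : Ω → ℝ, HasCompactSupport f := fun f => (isClosed_tsupport f).isCompact
  have hw_int : Integrable (fun U => Real.exp (act U)) ν := hw_cont.integrable_of_hasCompactSupport (hcs _)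
  have hZ : 0 < ∫ U, Real.exp (act U) ∂ν := integral_exp_pos hw_int
  have hFw : Integrable (fun U => F U * Real.exp (act U)) ν :=
    (hF.mul hw_cont).integrable_of_hasCompactSupport (hcs _)
  have hFFw : Integrable (fun U => F U * F U * Real.exp (act U)) ν :=
    ((hF.mul hF).mul hw_cont).integrable_of_hasCompactSupport (hcs _)
  set Z := ∫ U, Real.exp (act U) ∂ν with hZdef
  set c := (∫ U, F U * Real.exp (act U) ∂ν) / Z with hcdef
  -- `∫ (F - c)² e^{act} > 0`
  have hg : Continuous fun U => (F U - c) ^ 2 * Real.exp (act U) := by fun_prop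
  have hx : ∃ X, (F X - c) ^ 2 * Real.exp (act X) ≠ 0 := by
    by_contra hall
    push Not at hall
    have hU := hall U₀
    have hV := hall V₀
    rw [mul_eq_zero, sq_eq_zero_iff, sub_eq_zero] at hU hV
    rcases hU with hU | hU
    · rcases hV with hV | hV
      · exact hUV (hU.trans hV.symm)
      · exact (Real.exp_pos _).ne' hV
    · exact (Real.exp_pos _).ne' hU
  obtain ⟨X, hX⟩ := hx
  have hpos : 0 < ∫ U, (F U - c) ^ 2 * Real.exp (act U) ∂ν :=
    hg.integral_pos_of_hasCompactSupport_nonneg_nonzero (hcs _)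
      (fun U => mul_nonneg (sq_nonneg _) (Real.exp_pos _).le) hX
  have hexpand : ∫ U, (F U - c) ^ 2 * Real.exp (act U) ∂ν =
      (∫ U, F U * F U * Real.exp (act U) ∂ν - 2 * c * ∫ U, F U * Real.exp (act U) ∂ν) + c ^ 2 * Z := by
    have h1 : (fun U => (F U - c) ^ 2 * Real.exp (act U)) =
        fun U => (F U * F U * Real.exp (act U) - 2 * c * (F U * Real.exp (act U))) + c ^ 2 * Real.exp (act U) := by
      funext U; ring
    rw [h1, integral_add (f := fun U => F U * F U * Real.exp (act U) - 2 * c * (F U * Real.exp (act U)))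
        (g := fun U => c ^ 2 * Real.exp (act U)) (hFFw.sub (hFw.const_mul _)) (hw_int.const_mul _),
      integral_sub (f := fun U => F U * F U * Real.exp (act U)) (g := fun U => 2 * c * (F U * Real.exp (act U)))
        hFFw (hFw.const_mul _), integral_const_mul, integral_const_mul]
  have hcZ : ∫ U, F U * Real.exp (act U) ∂ν = c * Z := by
    rw [hcdef, div_mul_cancel₀ _ hZ.ne']
  rw [hexpand, hcZ] at hpos
  have hA : c * c * Z < ∫ U, F U * F U * Real.exp (act U) ∂ν := by nlinarith
  rw [sub_pos, lt_div_iff₀ hZ]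
  exact hA

/-- **Periodic copies kill an all-separations clustering bound (abstract form).**  If a ratio-of-integrals
Gibbs average clusters `F` against its shifts `F ∘ σ_n` at rate `m > 0` for ALL `n`, while the shifts by multiples
of some `L ≥ 1` fix `F` (time-periodicity of the tube), then `F` has vanishing variance — impossible for a
continuous `F` taking two values when `ν` charges open sets (`var_ratio_pos`). [folklore] -/
theorem allSep_bound_false {Ω : Type*} [MeasurableSpace Ω] [TopologicalSpace Ω] [OpensMeasurableSpace Ω]
    [CompactSpace Ω] (ν : Measure Ω) [IsProbabilityMeasure ν] [ν.IsOpenPosMeasure] {act : Ω → ℝ}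
    {F : Ω → ℝ} {σ : ℕ → Ω → Ω} {C m : ℝ} {L : ℕ}
    (key : ∀ n : ℕ, |(∫ U, F U * F (σ n U) * Real.exp (act U) ∂ν) / (∫ U, Real.exp (act U) ∂ν) -
        (∫ U, F U * Real.exp (act U) ∂ν) / (∫ U, Real.exp (act U) ∂ν) *
          ((∫ U, F (σ n U) * Real.exp (act U) ∂ν) / (∫ U, Real.exp (act U) ∂ν))| ≤ C * Real.exp (-(m * n)))
    (hσ : ∀ (k : ℕ) (U : Ω), F (σ (k * L) U) = F U) (hm : 0 < m) (hL : 1 ≤ L)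
    (hact : Continuous act) (hF : Continuous F) {U₀ V₀ : Ω} (hUV : F U₀ ≠ F V₀) : False := by
  -- the bound along `n = kL` tends to `0`
  have hlim : Tendsto (fun k : ℕ => C * Real.exp (-(m * ((k * L : ℕ) : ℝ)))) atTop (𝓝 0) := by
    have h1 : Tendsto (fun k : ℕ => m * ((k * L : ℕ) : ℝ)) atTop atTop := by
      have : (fun k : ℕ => m * ((k * L : ℕ) : ℝ)) = fun k : ℕ => m * (L : ℝ) * (k : ℝ) := by
        funext k; push_cast; ring
      rw [this]
      exact Tendsto.const_mul_atTop (mul_pos hm (by exact_mod_cast hL)) tendsto_natCast_atTop_atTop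
    have hexp := Real.tendsto_exp_atBot.comp (tendsto_neg_atTop_atBot.comp h1)
    simpa using hexp.const_mul C
  have hX : (∫ U, F U * F U * Real.exp (act U) ∂ν) / (∫ U, Real.exp (act U) ∂ν) -
      (∫ U, F U * Real.exp (act U) ∂ν) / (∫ U, Real.exp (act U) ∂ν) *
        ((∫ U, F U * Real.exp (act U) ∂ν) / (∫ U, Real.exp (act U) ∂ν)) ≤ 0 :=
    ge_of_tendsto' hlim fun k => by
      have hk := key (k * L)
      simp only [hσ k] at hk
      exact (le_abs_self _).trans hk
  exact (not_lt.2 hX) (var_ratio_pos ν hact hF hUV)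

/-- `TubeClusters` with the separation bound `2 * n < L →` deleted: clustering demanded at ALL separations `n` on
the tube of time-period `L`. [folklore] -/
def TubeClustersAllSep (G : Type) [Group G] [TopologicalSpace G] [IsTopologicalGroup G] [CompactSpace G]
    [MeasurableSpace G] [BorelSpace G] (r : LatticeRep G) (M : ℕ) (β m C : ℝ) (w Lmin : ℕ) : Prop :=
  ∀ (L : ℕ) [NeZero L], Lmin ≤ L → let St := ZMod L × ZMod L × Fin (M + 1) × Fin (M + 1); let Cfg := St × Fin 4 → G; let ν : MeasureTheory.Measure Cfg := MeasureTheory.Measure.pi fun _ => haarProbability G; let sh : St → Fin 4 → St := fun x μ => ![(x.1 + 1, x.2.1, x.2.2.1, x.2.2.2), (x.1, x.2.1 + 1, x.2.2.1, x.2.2.2), (x.1, x.2.1, x.2.2.1 + 1, x.2.2.2), (x.1, x.2.1, x.2.2.1, x.2.2.2 + 1)] μ; let ins : St → Fin 4 → Fin 4 → ℝ := fun x μ κ => if ((μ = 2 ∨ κ = 2) → (x.2.2.1 : ℕ) < M) ∧ ((μ = 3 ∨ κ = 3) → (x.2.2.2 : ℕ) < M) then 1 else 0; let pl : Cfg → St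 → Fin 4 → Fin 4 → G := fun U x μ κ => U (x, μ) * U (sh x μ, κ) * (U (sh x κ, μ))⁻¹ * (U (x, κ))⁻¹; let act : Cfg → ℝ := fun U => β * ∑ x : St, ∑ q : {q : Fin 4 × Fin 4 // q.1 < q.2}, ins x q.1.1 q.1.2 * (r.ρ (pl U x q.1.1 q.1.2)).trace.re; let wgt : Cfg → ℝ := fun U => Real.exp (act U); let Ex : (Cfg → ℝ) → ℝ := fun F => (∫ U, F U * wgt U ∂ν) / (∫ U, wgt U ∂ν); let σ : ℕ → Cfg → Cfg := fun n U p => U ((p.1.1 + n, p.1.2), p.2); ∀ c : ZMod L, let Loc := fun F : Cfg → ℝ => Measurable F ∧ (∀ U, |F U| ≤ 1) ∧ ∀ U U', (∀ p : St × Fin 4, (p.1.1 - c).val ≤ w → U p = U' p) → F U = F U'; ∀ F₁ F₂ : Cfg → ℝ, Loc F₁ → Loc F₂ → ∀ n : ℕ, |Ex (fun U => F₁ U * F₂ (σ n U)) - Ex F₁ * Ex (fun U => F₂ (σ n U))| ≤ C * Real.exp (-(m * n))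

/-- **The separation bound `2n < L` is load-bearing for the satisfiability of the hypothesis.**  With it deleted,
the tube predicate is FALSE for every non-trivial compact `G`, every faithful `r`, every width, coupling, slab
width, volume floor and constant, as soon as the rate is positive: the tube is periodic in time with period `L`,
so at separations `n = kL` the "two" observables coincide (`σ_{kL} = id`) and the bound `C e^{-mkL} → 0` forces
the variance of the normalised one-link character `Re tr r.ρ(U_ℓ)/N` to vanish — while it is positive (the tube
Gibbs weight is a positive continuous density against a product of Haar measures, which charges open sets, and the
character separates `U ≡ 1` from `U ≡ g₀ ≠ 1` by faithfulness).  So without `2n < L` the crux would close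
VACUOUSLY (its hypothesis unsatisfiable), cf. §2 for the dual clause `n ≤ S` of the conclusion. [folklore] -/
theorem tubeClustersAllSep_false [Nontrivial G] (r : LatticeRep G) (M : ℕ) (β : ℝ) {m : ℝ} (hm : 0 < m)
    (C : ℝ) (w Lmin : ℕ) : ¬ TubeClustersAllSep G r M β m C w Lmin := by
  haveI : SecondCountableTopology G :=
    (r.continuous.isClosedEmbedding r.injective).isEmbedding.secondCountableTopology
  haveI : (haarProbability G).IsOpenPosMeasure := by unfold haarProbability; infer_instance
  have hρ : Continuous fun g : G => ((r.ρ g).trace).re :=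
    Complex.continuous_re.comp r.continuous.matrix_trace
  obtain ⟨g₀, hg₀⟩ := exists_ne (1 : G)
  -- the representation space is non-zero and the character sees `g₀ ≠ 1`
  have hN : (r.N : ℝ) ≠ 0 := by
    intro h0
    have hN0 : r.N = 0 := by exact_mod_cast h0
    apply hg₀
    apply r.injective
    have : Subsingleton (Matrix (Fin r.N) (Fin r.N) ℂ) := by rw [hN0]; infer_instance
    exact Subsingleton.elim _ _
  have hNpos : (0 : ℝ) < r.N := lt_of_le_of_ne (Nat.cast_nonneg _) (Ne.symm hN)
  have htr : ((r.ρ g₀).trace).re ≠ r.N := fun h =>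
    hg₀ (r.injective (by rw [Literature.Barriers.QuantumFields.eq_one_of_re_trace_eq (r.mem_unitary g₀) h, map_one]))
  intro h
  set L := max Lmin 1 with hLdef
  have hL1 : 1 ≤ L := le_max_right _ _
  haveI : NeZero L := ⟨by omega⟩
  have hL := h L (le_max_left _ _)
  dsimp only at hL
  -- the observable: normalised one-link character at the link based at the origin, direction 0
  obtain ⟨F, hFdef⟩ : ∃ F : (((ZMod L × ZMod L × Fin (M + 1) × Fin (M + 1)) × Fin 4 → G) → ℝ),
      F = fun U => ((r.ρ (U ((0, 0, 0, 0), 0))).trace).re / r.N := ⟨_, rfl⟩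
  have hFcont : Continuous F := by
    rw [hFdef]
    exact (hρ.comp (continuous_apply _)).div_const _
  have hF1 : ∀ U, |F U| ≤ 1 := fun U => by
    rw [hFdef]; dsimp only
    rw [abs_div, Nat.abs_cast, div_le_one hNpos]
    exact abs_re_trace_le r _
  have hLoc : Measurable F ∧ (∀ U, |F U| ≤ 1) ∧
      ∀ U U' : (ZMod L × ZMod L × Fin (M + 1) × Fin (M + 1)) × Fin 4 → G,
        (∀ p : (ZMod L × ZMod L × Fin (M + 1) × Fin (M + 1)) × Fin 4, (p.1.1 - 0).val ≤ w → U p = U' p) →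
          F U = F U' :=
    ⟨hFcont.measurable, hF1, fun U U' hUU' => by rw [hFdef]; dsimp only; rw [hUU' ((0, 0, 0, 0), 0) (by simp)]⟩
  have key := hL 0 F F hLoc hLoc
  -- at separations `kL` the shifted observable is the observable
  have hσ : ∀ (k : ℕ) (U : (ZMod L × ZMod L × Fin (M + 1) × Fin (M + 1)) × Fin 4 → G),
      F (fun p => U ((p.1.1 + ((k * L : ℕ) : ZMod L), p.1.2), p.2)) = F U := by
    intro k U
    rw [hFdef]; dsimp only
    rw [Nat.cast_mul, ZMod.natCast_self, mul_zero, add_zero]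
  -- two configurations the observable separates
  have hUV : F (fun _ => 1) ≠ F (fun _ => g₀) := by
    rw [hFdef]; dsimp only
    rw [map_one, Matrix.trace_one, Fintype.card_fin, Complex.natCast_re, div_self hN]
    intro h1
    exact htr ((div_eq_one_iff_eq hN).1 h1.symm)
  exact allSep_bound_false (MeasureTheory.Measure.pi fun _ => haarProbability G) key hσ hm hL1
    (by
      refine continuous_const.mul (continuous_finsetSum _ fun x _ =>
        continuous_finsetSum _ fun q _ => continuous_const.mul (hρ.comp ?_))
      fun_prop)
    hFcont hUV

/-- Hence the crux with `2 * n < L →` deleted from its hypothesis holds VACUOUSLY (for every `(G, r)` admitted: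
compact simple groups are non-trivial).  The hypothesis so mutated is never satisfied. [folklore] -/
theorem tubeFamilyAllSep_false [Nontrivial G] (r : LatticeRep G) :
    ¬ ∃ β₁ : ℝ, ∀ β : ℝ, β₁ ≤ β → ∃ m : ℝ, 0 < m ∧ ∀ w : ℕ, ∃ C : ℝ, ∀ M : ℕ, ∃ Lmin : ℕ,
      TubeClustersAllSep G r M β m C w Lmin := by
  rintro ⟨β₁, h⟩
  obtain ⟨m, hm, h⟩ := h β₁ le_rfl
  obtain ⟨C, h⟩ := h 0
  obtain ⟨Lmin, h⟩ := h 0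
  exact tubeClustersAllSep_false r 0 β₁ hm C 0 Lmin h

/-! ## §5 Non-vacuity in kind: at `β = 0` the tube predicate holds for EVERY rate, `C(w) = 2e^{mw}`, `Lmin = 0` -/

/-- **At zero coupling the free-tube family holds in kind, for every rate.**  For every compact `G`, faithful `r`,
width `M`, rate `m ≥ 0` and slab width `w`: `TubeClusters G r M 0 m (2 e^{mw}) w 0`.  At `β = 0` the weight is `1`
and the tube measure is the product of Haar probability measures, so (i) for `n ≤ w` the a-priori bound `2`
(`cov_ratio_le_two`) is below `2e^{mw}e^{-mn}`, and (ii) for `w < n` (and `2n < L`) the slab `[c, c+w]` and its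
shift by `n` are DISJOINT sets of links mod `L`, on which `F₁` and `F₂ ∘ σ_n` respectively depend, so the
covariance vanishes exactly (tree `LatticeGapOnTrajectory.Negative.integral_mul_eq_of_dependsOn_disjoint`,
Mathlib `iIndepFun_pi`).  This certifies the quantifier placement of the hypothesis (`C` after `w`, before `M`
and `L`; `Lmin` idle) and exercises the inline vocabulary (`Loc`, `σ`, `ZMod.val` slab arithmetic) once in Lean —
the bookkeeping stub (T) of lines `birth`/`uniqueness` needs verbatim. [folklore] -/
theorem tubeClusters_coupling_zero (r : LatticeRep G) (M : ℕ) {m : ℝ} (hm : 0 ≤ m) (w : ℕ) :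
    TubeClusters G r M 0 m (2 * Real.exp (m * w)) w 0 := by
  classical
  haveI : SecondCountableTopology G :=
    (r.continuous.isClosedEmbedding r.injective).isEmbedding.secondCountableTopology
  have hρ : Continuous fun g : G => ((r.ρ g).trace).re :=
    Complex.continuous_re.comp r.continuous.matrix_trace
  intro L _ _
  dsimp only
  intro c F₁ F₂ hF₁ hF₂ n hn
  by_cases hnw : n ≤ w
  · -- overlapping slabs: the a-priori bound `2 ≤ 2 e^{mw} e^{-mn}`
    refine (cov_ratio_le_two (MeasureTheory.Measure.pi fun _ => haarProbability G) ?_ hF₁.2.1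
      (fun U => hF₂.2.1 _)).trans ?_
    · refine continuous_const.mul (continuous_finsetSum _ fun x _ =>
        continuous_finsetSum _ fun q _ => continuous_const.mul (hρ.comp ?_))
      fun_prop
    · rw [mul_assoc, ← Real.exp_add]
      have hnw' : (n : ℝ) ≤ w := by exact_mod_cast hnw
      have h0 : 0 ≤ m * (w : ℝ) + -(m * n) := by nlinarith
      nlinarith [Real.add_one_le_exp (m * (w : ℝ) + -(m * n))]
  · -- disjoint slabs: at `β = 0` the weight is `1`, and the covariance factorises exactly
    push Not at hnw
    simp only [zero_mul, Real.exp_zero, mul_one, integral_const, smul_eq_mul, probReal_univ, div_one]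
    -- the two index sets
    set I : Finset ((ZMod L × ZMod L × Fin (M + 1) × Fin (M + 1)) × Fin 4) :=
      Finset.univ.filter fun p => (p.1.1 - c).val ≤ w with hI
    set J : Finset ((ZMod L × ZMod L × Fin (M + 1) × Fin (M + 1)) × Fin 4) :=
      Finset.univ.filter fun p => (p.1.1 - (n : ZMod L) - c).val ≤ w with hJ
    have hIJ : Disjoint I J := by
      rw [hI, hJ, Finset.disjoint_filter]
      intro q _ h1 h2
      have hnL : n < L := by omega
      have hval : ((n : ZMod L)).val = n := ZMod.val_natCast_of_lt hnL
      have heq : q.1.1 - c = (q.1.1 - (n : ZMod L) - c) + (n : ZMod L) := by ring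
      have hadd := ZMod.val_add (q.1.1 - (n : ZMod L) - c) (n : ZMod L)
      rw [← heq, hval] at hadd
      have hlt : (q.1.1 - (n : ZMod L) - c).val + n < L := by omega
      rw [Nat.mod_eq_of_lt hlt] at hadd
      omega
    have hdep₁ : DependsOn F₁ (↑I : Set ((ZMod L × ZMod L × Fin (M + 1) × Fin (M + 1)) × Fin 4)) := by
      intro U U' h
      exact hF₁.2.2 U U' fun p hp => h p (by rw [hI]; simpa using hp)
    have hdep₂ : DependsOn (fun U : (ZMod L × ZMod L × Fin (M + 1) × Fin (M + 1)) × Fin 4 → G =>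
        F₂ (fun p => U ((p.1.1 + (n : ZMod L), p.1.2), p.2)))
        (↑J : Set ((ZMod L × ZMod L × Fin (M + 1) × Fin (M + 1)) × Fin 4)) := by
      intro U U' h
      refine hF₂.2.2 _ _ fun p hp => h ((p.1.1 + (n : ZMod L), p.1.2), p.2) ?_
      rw [hJ]
      simpa [add_sub_cancel_right] using hp
    have hσm : Measurable fun (U : (ZMod L × ZMod L × Fin (M + 1) × Fin (M + 1)) × Fin 4 → G) =>
        fun p : (ZMod L × ZMod L × Fin (M + 1) × Fin (M + 1)) × Fin 4 => U ((p.1.1 + (n : ZMod L), p.1.2), p.2) :=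
      measurable_pi_lambda _ fun p => measurable_pi_apply _
    have hfac := Summit.QuantumFields.YangMills.Theorems.LatticeGapOnTrajectory.Negative.integral_mul_eq_of_dependsOn_disjoint
      (haarProbability G) I J hIJ hdep₁ hdep₂ hF₁.1 (hF₂.1.comp hσm)
    rw [hfac, sub_self, abs_zero]
    positivity

/-- So at `β = 0` the hypothesis PREFIX of `FibreToTorus` is met by every `(G, r)` for every rate (take `β₁ ≤ 0`
… but only AT `β = 0`, of course: the family is asked for all `β ≥ β₁`).  Recorded as the one-coupling witness:
`∀ m > 0, ∀ w, ∃ C, ∀ M, ∃ Lmin, TubeClusters G r M 0 m C w Lmin`. [folklore] -/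
theorem tubeFamily_prefix_at_coupling_zero (r : LatticeRep G) {m : ℝ} (hm : 0 < m) :
    ∀ w : ℕ, ∃ C : ℝ, ∀ M : ℕ, ∃ Lmin : ℕ, TubeClusters G r M 0 m C w Lmin :=
  fun w => ⟨2 * Real.exp (m * w), fun M => ⟨0, tubeClusters_coupling_zero r M hm.le w⟩⟩

end Summit.QuantumFields.YangMills.Cruxes.FibreToTorus.Disproof

end
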